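import Literature.MathematicalPhysics.QuantumFieldTheory.GaussianPoissonZn
import HarnessLib

/-!
# Tilted theta series of a positive definite form are positive (any rank)

For a positive definite real `N × N` matrix `B` and ANY real vector `m`,
```
  0 < Σ_{ρ ∈ ℤᴺ} e^{−2π² ρᵀBρ} cos(2π ρ·m),
```
and more precisely (the theta transformation of `GaussianPoissonZn`, read from the dual side)
`Σ_ρ e^{−2π² ρᵀBρ} cos(2π ρ·m) = Z_{B⁻¹}⁻¹ Σ_{k ∈ ℤᴺ} e^{−½ (k−m)ᵀB⁻¹(k−m)}` is a sum of POSITIVE Gaussians: a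
theta series with real characteristic (a "tilted" or "twisted" theta series, the Fourier series of the wrapped Gaussian
of covariance `4π²B`) never vanishes and is real, although for small `B` it may be exponentially smaller than the
untilted series (`m = 0`).  Rescaled form: `0 < Σ_ρ e^{−½ ρᵀAρ} cos(τ·ρ)` for every positive definite `A` and every
`τ ∈ ℝᴺ` (`tsum_exp_neg_half_form_mul_cos_pos`); the sine series vanishes (`tsum_exp_neg_half_form_mul_sin_eq_zero`),
so the complex tilted series `Σ_ρ e^{−½ρᵀAρ + iτ·ρ}` is a positive real (`tsum_cexp_tilted_eq`, `…_re_pos`).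

Used for the holonomy (flux) sectors of abelian lattice models: the Gaussian weights of the flux sectors of a
`U(1)` model on a torus with a Berry/theta term form exactly such a series (rank 3), whose positivity is the Gaussian
level of the `q = 0` positivity endgame (Fröhlich–Spencer flux sectors; Poisson dual = charge sectors).

Also proved here (generic, used to discharge the hypotheses of `GaussianPoisson.tsum_exp_neg_half_form_sub_eq`):
every positive definite real matrix admits two-sided bounds `c‖v‖² ≤ vᵀPv ≤ C‖v‖²` with `0 < c, C`
(`exists_form_bounds_of_posDef`).

No definitions; no named facts. [folklore; cf. Fröhlich–Spencer, CMP 83 (1982) §2.6; Mumford, Tata Lectures on Theta I §1]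
-/

noncomputable section

open MeasureTheory Complex Matrix WithLp Filter
open scoped Real InnerProductSpace ENNReal Topology BigOperators
open Literature.MathematicalPhysics.QuantumFieldTheory.GaussianToolkit

namespace Literature.MathematicalPhysics.QuantumFieldTheory

namespace GaussianPoisson

variable {N : ℕ} {P : Matrix (Fin N) (Fin N) ℝ}

/-! ### Two-sided bounds for positive definite forms -/

/-- A coordinate is bounded by the euclidean norm: `|v i| ≤ ‖v‖₂`. [folklore] -/
theorem abs_apply_le_norm_toLp (v : Fin N → ℝ) (i : Fin N) :
    |v i| ≤ ‖(toLp 2 v : EuclideanSpace ℝ (Fin N))‖ := by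
  have h := PiLp.norm_apply_le (toLp 2 v : EuclideanSpace ℝ (Fin N)) i
  simpa using h

/-- **Upper bound**: `vᵀPv ≤ (Σ_{ij} |P_{ij}|) · ‖v‖₂²` for every real square matrix. [folklore] -/
theorem form_le_sum_abs_mul_norm_sq (P : Matrix (Fin N) (Fin N) ℝ) (v : Fin N → ℝ) :
    v ⬝ᵥ P *ᵥ v ≤ (∑ i, ∑ j, |P i j|) * ‖(toLp 2 v : EuclideanSpace ℝ (Fin N))‖ ^ 2 := by
  set n := ‖(toLp 2 v : EuclideanSpace ℝ (Fin N))‖ with hn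
  have hn0 : 0 ≤ n := norm_nonneg _
  have hexp : v ⬝ᵥ P *ᵥ v = ∑ i, ∑ j, P i j * (v i * v j) := by
    simp only [dotProduct, mulVec, Finset.mul_sum]
    exact Finset.sum_congr rfl fun i _ => Finset.sum_congr rfl fun j _ => by ring
  rw [hexp, Finset.sum_mul]
  refine Finset.sum_le_sum fun i _ => ?_
  rw [Finset.sum_mul]
  refine Finset.sum_le_sum fun j _ => ?_
  have hi := abs_apply_le_norm_toLp v i
  have hj := abs_apply_le_norm_toLp v j
  calc P i j * (v i * v j) ≤ |P i j * (v i * v j)| := le_abs_self _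
    _ = |P i j| * (|v i| * |v j|) := by rw [abs_mul, abs_mul]
    _ ≤ |P i j| * (n * n) := mul_le_mul_of_nonneg_left
        (mul_le_mul hi hj (abs_nonneg _) hn0) (abs_nonneg _)
    _ = |P i j| * n ^ 2 := by ring

/-- **Lower bound (coercivity)**: a positive definite real matrix satisfies `c‖v‖₂² ≤ vᵀPv` for some `c > 0`
(minimum of the form over the compact unit sphere). [folklore] -/
theorem exists_pos_mul_norm_sq_le_form (hP : P.PosDef) :
    ∃ c : ℝ, 0 < c ∧ ∀ v : Fin N → ℝ, c * ‖(toLp 2 v : EuclideanSpace ℝ (Fin N))‖ ^ 2 ≤ v ⬝ᵥ P *ᵥ v := by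
  -- the form as a continuous function on the euclidean space
  set f : EuclideanSpace ℝ (Fin N) → ℝ := fun x => ofLp x ⬝ᵥ P *ᵥ ofLp x with hf
  have hcont : Continuous f :=
    (PiLp.continuous_ofLp 2 _).dotProduct (continuous_const.matrix_mulVec (PiLp.continuous_ofLp 2 _))
  have hpos : ∀ x : EuclideanSpace ℝ (Fin N), x ≠ 0 → 0 < f x := by
    intro x hx
    have hx' : ofLp x ≠ 0 := fun h => hx (by simpa using congrArg (toLp 2) h)
    have h := hP.dotProduct_mulVec_pos hx'
    simpa [hf, dotProduct_mulVec] using h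
  have hscale : ∀ (t : ℝ) (x : EuclideanSpace ℝ (Fin N)), f (t • x) = t ^ 2 * f x := by
    intro t x
    simp only [hf, ofLp_smul, smul_dotProduct, mulVec_smul, dotProduct_smul, smul_eq_mul]
    ring
  by_cases hne : (Metric.sphere (0 : EuclideanSpace ℝ (Fin N)) 1).Nonempty
  · obtain ⟨x₀, hx₀, hmin⟩ := (isCompact_sphere (0 : EuclideanSpace ℝ (Fin N)) 1).exists_isMinOn hne hcont.continuousOn
    have hx₀ne : x₀ ≠ 0 := by
      intro h
      rw [h, mem_sphere_zero_iff_norm, norm_zero] at hx₀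
      exact zero_ne_one hx₀
    refine ⟨f x₀, hpos x₀ hx₀ne, fun v => ?_⟩
    set x : EuclideanSpace ℝ (Fin N) := toLp 2 v with hx
    have hfx : f x = v ⬝ᵥ P *ᵥ v := by simp [hf, hx]
    rw [← hfx]
    by_cases hv : x = 0
    · rw [hv, norm_zero]
      have : f 0 = 0 := by simp [hf]
      rw [this]; simp
    have hnx : ‖x‖ ≠ 0 := norm_ne_zero_iff.2 hv
    have hunit : ‖x‖⁻¹ • x ∈ Metric.sphere (0 : EuclideanSpace ℝ (Fin N)) 1 := by
      rw [mem_sphere_zero_iff_norm, norm_smul, norm_inv, norm_norm, inv_mul_cancel₀ hnx]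
    have hle : f x₀ ≤ f (‖x‖⁻¹ • x) := hmin hunit
    have hfx' : f x = ‖x‖ ^ 2 * f (‖x‖⁻¹ • x) := by
      rw [hscale, inv_pow, ← mul_assoc, mul_inv_cancel₀ (pow_ne_zero 2 hnx), one_mul]
    rw [hfx', mul_comm]
    exact mul_le_mul_of_nonneg_left hle (sq_nonneg _)
  · refine ⟨1, one_pos, fun v => ?_⟩
    set x : EuclideanSpace ℝ (Fin N) := toLp 2 v with hx
    by_cases hv : x = 0
    · have hv' : v = 0 := by simpa [hx] using congrArg ofLp hv
      rw [hv, norm_zero, hv']; simp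
    · have hnx : ‖x‖ ≠ 0 := norm_ne_zero_iff.2 hv
      exact absurd ⟨‖x‖⁻¹ • x, by
        rw [mem_sphere_zero_iff_norm, norm_smul, norm_inv, norm_norm, inv_mul_cancel₀ hnx]⟩ hne

/-- **Two-sided bounds of a positive definite form**: `c‖v‖₂² ≤ vᵀPv ≤ C‖v‖₂²` with `0 < c, C` — the hypotheses of the
theta transformation `tsum_exp_neg_half_form_sub_eq`. [folklore] -/
theorem exists_form_bounds_of_posDef (hP : P.PosDef) :
    ∃ c C : ℝ, 0 < c ∧ 0 < C ∧
      (∀ v : Fin N → ℝ, c * ‖(toLp 2 v : EuclideanSpace ℝ (Fin N))‖ ^ 2 ≤ v ⬝ᵥ P *ᵥ v) ∧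
      (∀ v : Fin N → ℝ, v ⬝ᵥ P *ᵥ v ≤ C * ‖(toLp 2 v : EuclideanSpace ℝ (Fin N))‖ ^ 2) := by
  obtain ⟨c, hc, hlow⟩ := exists_pos_mul_norm_sq_le_form hP
  refine ⟨c, (∑ i, ∑ j, |P i j|) + 1, hc, by positivity, hlow, fun v => ?_⟩
  have h := form_le_sum_abs_mul_norm_sq P v
  nlinarith [sq_nonneg ‖(toLp 2 v : EuclideanSpace ℝ (Fin N))‖]

/-! ### Positivity of tilted theta series -/

/-- The Gaussian series `Σ_k e^{−½(k−m)ᵀP(k−m)}` over `ℤᴺ` is summable (positive definite `P`). [folklore] -/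
theorem summable_exp_neg_half_form_sub (hP : P.PosDef) (m : Fin N → ℝ) :
    Summable fun k : Fin N → ℤ => Real.exp (-((fun j => (k j : ℝ) - m j) ⬝ᵥ P *ᵥ (fun j => (k j : ℝ) - m j)) / 2) := by
  obtain ⟨c, hc, hlow⟩ := exists_pos_mul_norm_sq_le_form hP
  have h := (summable_gauss_stdIntLattice hc hlow (toLp 2 m)).comp_injective (stdIntLatticeEquiv N).injective
  refine h.congr fun k => ?_
  simp only [Function.comp_apply, gauss, ofLp_stdIntLatticeEquiv_sub]

/-- The Gaussian series `Σ_k e^{−½(k−m)ᵀP(k−m)}` over `ℤᴺ` is POSITIVE. [folklore] -/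
theorem tsum_exp_neg_half_form_sub_pos (hP : P.PosDef) (m : Fin N → ℝ) :
    0 < ∑' k : Fin N → ℤ, Real.exp (-((fun j => (k j : ℝ) - m j) ⬝ᵥ P *ᵥ (fun j => (k j : ℝ) - m j)) / 2) :=
  (summable_exp_neg_half_form_sub hP m).tsum_pos (fun _ => (Real.exp_pos _).le) 0 (Real.exp_pos _)

/-- **Tilted theta series are positive** (normalisation of the theta transformation): for a positive definite `P`
and every `m ∈ ℝᴺ`, `0 < Σ_{ρ ∈ ℤᴺ} e^{−2π² ρᵀP⁻¹ρ} cos(2π ρ·m)`, and the normalising constant `Z_P` is positive.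
[folklore] -/
theorem gaussZ_toReal_pos_and_tsum_dual_pos (hP : P.PosDef) (m : Fin N → ℝ) :
    0 < (gaussZ P).toReal ∧
      0 < ∑' ρ : Fin N → ℤ, Real.exp (-2 * π ^ 2 * ((fun j => (ρ j : ℝ)) ⬝ᵥ P⁻¹ *ᵥ fun j => (ρ j : ℝ))) *
        Real.cos (2 * π * ∑ j, (ρ j : ℝ) * m j) := by
  obtain ⟨c, C, hc, hC, hlow, hup⟩ := exists_form_bounds_of_posDef hP
  have hid := tsum_exp_neg_half_form_sub_eq hP hc hC hlow hup m
  have hpos := tsum_exp_neg_half_form_sub_pos hP m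
  rw [hid] at hpos
  have hZ : 0 ≤ (gaussZ P).toReal := ENNReal.toReal_nonneg
  have hZpos : 0 < (gaussZ P).toReal := by
    rcases hZ.lt_or_eq with h | h
    · exact h
    · rw [← h, zero_mul] at hpos; exact absurd hpos (lt_irrefl 0)
  exact ⟨hZpos, pos_of_mul_pos_right hpos hZ⟩

/-- **Tilted theta series are positive, covariance form**: for a positive definite `A` and every `τ ∈ ℝᴺ`,
`0 < Σ_{ρ ∈ ℤᴺ} e^{−½ ρᵀAρ} cos(τ·ρ)`. (The normalised form for `P = (A/(4π²))⁻¹`, `m = τ/(2π)`.) [folklore] -/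
theorem tsum_exp_neg_half_form_mul_cos_pos {A : Matrix (Fin N) (Fin N) ℝ} (hA : A.PosDef) (τ : Fin N → ℝ) :
    0 < ∑' ρ : Fin N → ℤ, Real.exp (-((fun j => (ρ j : ℝ)) ⬝ᵥ A *ᵥ fun j => (ρ j : ℝ)) / 2) *
      Real.cos (∑ j, (ρ j : ℝ) * τ j) := by
  -- `B := A/(4π²)` and `P := B⁻¹`, so that `P⁻¹ = B`
  have h4 : (0 : ℝ) < (4 * π ^ 2)⁻¹ := by positivity
  set B : Matrix (Fin N) (Fin N) ℝ := (4 * π ^ 2)⁻¹ • A with hB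
  have hBpd : B.PosDef := hA.smul h4
  have hPpd : B⁻¹.PosDef := hBpd.inv
  have hBunit : IsUnit B.det := (Matrix.isUnit_iff_isUnit_det _).1 hBpd.isUnit
  have hPinv : B⁻¹⁻¹ = B := Matrix.nonsing_inv_nonsing_inv B hBunit
  have h := (gaussZ_toReal_pos_and_tsum_dual_pos hPpd (fun j => τ j / (2 * π))).2
  rw [hPinv] at h
  convert h using 1
  refine tsum_congr fun ρ => ?_
  congr 1
  · congr 1
    simp only [hB, Matrix.smul_mulVec, dotProduct_smul, smul_eq_mul]
    field_simp
    ring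
  · congr 1
    rw [Finset.mul_sum]
    refine Finset.sum_congr rfl fun j _ => ?_
    field_simp

/-- The tilted Gaussian family `e^{−½ρᵀAρ} cos(τ·ρ)` is summable. [folklore] -/
theorem summable_exp_neg_half_form_mul_cos {A : Matrix (Fin N) (Fin N) ℝ} (hA : A.PosDef) (τ : Fin N → ℝ) :
    Summable fun ρ : Fin N → ℤ => Real.exp (-((fun j => (ρ j : ℝ)) ⬝ᵥ A *ᵥ fun j => (ρ j : ℝ)) / 2) *
      Real.cos (∑ j, (ρ j : ℝ) * τ j) := by
  have hs := summable_exp_neg_half_form_sub hA 0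
  simp only [Pi.zero_apply, sub_zero] at hs
  refine hs.of_norm_bounded (fun ρ => ?_)
  rw [Real.norm_eq_abs, abs_mul, Real.abs_exp]
  exact mul_le_of_le_one_right (Real.exp_pos _).le (Real.abs_cos_le_one _)

/-- The tilted Gaussian family `e^{−½ρᵀAρ} sin(τ·ρ)` is summable. [folklore] -/
theorem summable_exp_neg_half_form_mul_sin {A : Matrix (Fin N) (Fin N) ℝ} (hA : A.PosDef) (τ : Fin N → ℝ) :
    Summable fun ρ : Fin N → ℤ => Real.exp (-((fun j => (ρ j : ℝ)) ⬝ᵥ A *ᵥ fun j => (ρ j : ℝ)) / 2) *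
      Real.sin (∑ j, (ρ j : ℝ) * τ j) := by
  have hs := summable_exp_neg_half_form_sub hA 0
  simp only [Pi.zero_apply, sub_zero] at hs
  refine hs.of_norm_bounded (fun ρ => ?_)
  rw [Real.norm_eq_abs, abs_mul, Real.abs_exp]
  exact mul_le_of_le_one_right (Real.exp_pos _).le (Real.abs_sin_le_one _)

/-- **The sine series vanishes**: `Σ_ρ e^{−½ρᵀAρ} sin(τ·ρ) = 0` (the summand is odd under `ρ ↦ −ρ`). [folklore] -/
theorem tsum_exp_neg_half_form_mul_sin_eq_zero (A : Matrix (Fin N) (Fin N) ℝ) (τ : Fin N → ℝ) :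
    ∑' ρ : Fin N → ℤ, Real.exp (-((fun j => (ρ j : ℝ)) ⬝ᵥ A *ᵥ fun j => (ρ j : ℝ)) / 2) *
      Real.sin (∑ j, (ρ j : ℝ) * τ j) = 0 := by
  set f : (Fin N → ℤ) → ℝ := fun ρ => Real.exp (-((fun j => (ρ j : ℝ)) ⬝ᵥ A *ᵥ fun j => (ρ j : ℝ)) / 2) *
      Real.sin (∑ j, (ρ j : ℝ) * τ j) with hf
  have hodd : ∀ ρ, f (-ρ) = -f ρ := by
    intro ρ
    simp only [hf, Pi.neg_apply, Int.cast_neg]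
    have h1 : ((fun j => -(ρ j : ℝ)) ⬝ᵥ A *ᵥ fun j => -(ρ j : ℝ)) = ((fun j => (ρ j : ℝ)) ⬝ᵥ A *ᵥ fun j => (ρ j : ℝ)) := by
      have : (fun j => -(ρ j : ℝ)) = -(fun j => (ρ j : ℝ)) := rfl
      rw [this, neg_dotProduct, mulVec_neg, dotProduct_neg, neg_neg]
    have h2 : ∑ j, -(ρ j : ℝ) * τ j = -∑ j, (ρ j : ℝ) * τ j := by
      rw [← Finset.sum_neg_distrib]; exact Finset.sum_congr rfl fun j _ => by ring
    rw [h1, h2, Real.sin_neg, mul_neg]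
  have heq : ∑' ρ, f ρ = ∑' ρ, f (-ρ) := ((Equiv.neg (Fin N → ℤ)).tsum_eq f).symm
  simp only [hodd, tsum_neg] at heq
  show ∑' ρ, f ρ = 0
  linarith

/-- **The complex tilted theta series is the (positive) cosine series**:
`Σ_ρ e^{−½ρᵀAρ} e^{iτ·ρ} = Σ_ρ e^{−½ρᵀAρ} cos(τ·ρ)` as a complex number. [folklore] -/
theorem tsum_cexp_tilted_eq {A : Matrix (Fin N) (Fin N) ℝ} (hA : A.PosDef) (τ : Fin N → ℝ) :
    ∑' ρ : Fin N → ℤ, (Real.exp (-((fun j => (ρ j : ℝ)) ⬝ᵥ A *ᵥ fun j => (ρ j : ℝ)) / 2) : ℂ) *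
        Complex.exp ((∑ j, (ρ j : ℝ) * τ j : ℝ) * I)
      = ((∑' ρ : Fin N → ℤ, Real.exp (-((fun j => (ρ j : ℝ)) ⬝ᵥ A *ᵥ fun j => (ρ j : ℝ)) / 2) *
          Real.cos (∑ j, (ρ j : ℝ) * τ j) : ℝ) : ℂ) := by
  have hc := summable_exp_neg_half_form_mul_cos hA τ
  have hs := summable_exp_neg_half_form_mul_sin hA τ
  have hterm : ∀ ρ : Fin N → ℤ, (Real.exp (-((fun j => (ρ j : ℝ)) ⬝ᵥ A *ᵥ fun j => (ρ j : ℝ)) / 2) : ℂ) *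
      Complex.exp ((∑ j, (ρ j : ℝ) * τ j : ℝ) * I)
      = ((Real.exp (-((fun j => (ρ j : ℝ)) ⬝ᵥ A *ᵥ fun j => (ρ j : ℝ)) / 2) * Real.cos (∑ j, (ρ j : ℝ) * τ j) : ℝ) : ℂ)
        + ((Real.exp (-((fun j => (ρ j : ℝ)) ⬝ᵥ A *ᵥ fun j => (ρ j : ℝ)) / 2) * Real.sin (∑ j, (ρ j : ℝ) * τ j) : ℝ) : ℂ)
          * I := by
    intro ρ
    rw [Complex.exp_mul_I, ← Complex.ofReal_cos, ← Complex.ofReal_sin]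
    push_cast
    ring
  simp only [hterm]
  have h1 := Complex.hasSum_ofReal.2 hc.hasSum
  have h2 := (Complex.hasSum_ofReal.2 hs.hasSum).mul_right I
  rw [(h1.add h2).tsum_eq, tsum_exp_neg_half_form_mul_sin_eq_zero A τ]
  simp

/-- **The complex tilted theta series has positive real part and zero imaginary part.** [folklore] -/
theorem tsum_cexp_tilted_re_pos {A : Matrix (Fin N) (Fin N) ℝ} (hA : A.PosDef) (τ : Fin N → ℝ) :
    0 < (∑' ρ : Fin N → ℤ, (Real.exp (-((fun j => (ρ j : ℝ)) ⬝ᵥ A *ᵥ fun j => (ρ j : ℝ)) / 2) : ℂ) *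
        Complex.exp ((∑ j, (ρ j : ℝ) * τ j : ℝ) * I)).re ∧
      (∑' ρ : Fin N → ℤ, (Real.exp (-((fun j => (ρ j : ℝ)) ⬝ᵥ A *ᵥ fun j => (ρ j : ℝ)) / 2) : ℂ) *
        Complex.exp ((∑ j, (ρ j : ℝ) * τ j : ℝ) * I)).im = 0 := by
  rw [tsum_cexp_tilted_eq hA τ, Complex.ofReal_re, Complex.ofReal_im]
  exact ⟨tsum_exp_neg_half_form_mul_cos_pos hA τ, rfl⟩

/-! ### Quantitative bounds, uniform in the tilt

The theta transformation writes the tilted series as `Z_P⁻¹` times a sum of positive Gaussians centred at the lattice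
points; keeping the nearest lattice point gives a lower bound which is UNIFORM IN THE TILT, and `|cos| ≤ 1` gives the
untilted series as an upper bound.  (For small `P⁻¹` the tilted series is exponentially smaller than the untilted one —
the lower bound is then also exponentially small, as it must be.) -/

/-- **Single-term lower bound**: for every integer vector `k`,
`Z_P⁻¹ · e^{−½(k−m)ᵀP(k−m)} ≤ Σ_ρ e^{−2π² ρᵀP⁻¹ρ} cos(2π ρ·m)`. [folklore] -/
theorem inv_gaussZ_mul_exp_le_tsum_dual (hP : P.PosDef) (m : Fin N → ℝ) (k : Fin N → ℤ) :
    (gaussZ P).toReal⁻¹ * Real.exp (-((fun j => (k j : ℝ) - m j) ⬝ᵥ P *ᵥ (fun j => (k j : ℝ) - m j)) / 2)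
      ≤ ∑' ρ : Fin N → ℤ, Real.exp (-2 * π ^ 2 * ((fun j => (ρ j : ℝ)) ⬝ᵥ P⁻¹ *ᵥ fun j => (ρ j : ℝ))) *
          Real.cos (2 * π * ∑ j, (ρ j : ℝ) * m j) := by
  obtain ⟨c, C, hc, hC, hlow, hup⟩ := exists_form_bounds_of_posDef hP
  have hid := tsum_exp_neg_half_form_sub_eq hP hc hC hlow hup m
  have hZ := (gaussZ_toReal_pos_and_tsum_dual_pos hP m).1
  have hterm : Real.exp (-((fun j => (k j : ℝ) - m j) ⬝ᵥ P *ᵥ (fun j => (k j : ℝ) - m j)) / 2)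
      ≤ ∑' k : Fin N → ℤ, Real.exp (-((fun j => (k j : ℝ) - m j) ⬝ᵥ P *ᵥ (fun j => (k j : ℝ) - m j)) / 2) :=
    (summable_exp_neg_half_form_sub hP m).le_tsum k (fun j _ => (Real.exp_pos _).le)
  rw [hid] at hterm
  calc (gaussZ P).toReal⁻¹ * Real.exp (-((fun j => (k j : ℝ) - m j) ⬝ᵥ P *ᵥ (fun j => (k j : ℝ) - m j)) / 2)
      ≤ (gaussZ P).toReal⁻¹ * ((gaussZ P).toReal * ∑' ρ : Fin N → ℤ,
          Real.exp (-2 * π ^ 2 * ((fun j => (ρ j : ℝ)) ⬝ᵥ P⁻¹ *ᵥ fun j => (ρ j : ℝ))) *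
            Real.cos (2 * π * ∑ j, (ρ j : ℝ) * m j)) :=
        mul_le_mul_of_nonneg_left hterm (inv_nonneg.2 hZ.le)
    _ = _ := by rw [← mul_assoc, inv_mul_cancel₀ hZ.ne', one_mul]

/-- The form at a vector with coordinates in `[−½, ½]` is at most `¼ Σ_{ij} |P_{ij}|`. [folklore] -/
theorem form_le_quarter_sum_abs (P : Matrix (Fin N) (Fin N) ℝ) {v : Fin N → ℝ} (hv : ∀ j, |v j| ≤ 1 / 2) :
    v ⬝ᵥ P *ᵥ v ≤ (∑ i, ∑ j, |P i j|) / 4 := by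
  have hexp : v ⬝ᵥ P *ᵥ v = ∑ i, ∑ j, P i j * (v i * v j) := by
    simp only [dotProduct, mulVec, Finset.mul_sum]
    exact Finset.sum_congr rfl fun i _ => Finset.sum_congr rfl fun j _ => by ring
  rw [hexp, Finset.sum_div]
  refine Finset.sum_le_sum fun i _ => ?_
  rw [Finset.sum_div]
  refine Finset.sum_le_sum fun j _ => ?_
  have hi := hv i
  have hj := hv j
  calc P i j * (v i * v j) ≤ |P i j * (v i * v j)| := le_abs_self _
    _ = |P i j| * (|v i| * |v j|) := by rw [abs_mul, abs_mul]
    _ ≤ |P i j| * (1 / 2 * (1 / 2)) :=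
        mul_le_mul_of_nonneg_left (mul_le_mul hi hj (abs_nonneg _) (by norm_num)) (abs_nonneg _)
    _ = |P i j| / 4 := by ring

/-- **Uniform lower bound for the tilted theta series** (nearest lattice point): for every tilt `m`,
`Z_P⁻¹ · e^{−Σ_{ij}|P_{ij}|/8} ≤ Σ_ρ e^{−2π² ρᵀP⁻¹ρ} cos(2π ρ·m)`. [folklore] -/
theorem inv_gaussZ_mul_exp_le_tsum_dual_uniform (hP : P.PosDef) (m : Fin N → ℝ) :
    (gaussZ P).toReal⁻¹ * Real.exp (-(∑ i, ∑ j, |P i j|) / 8)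
      ≤ ∑' ρ : Fin N → ℤ, Real.exp (-2 * π ^ 2 * ((fun j => (ρ j : ℝ)) ⬝ᵥ P⁻¹ *ᵥ fun j => (ρ j : ℝ))) *
          Real.cos (2 * π * ∑ j, (ρ j : ℝ) * m j) := by
  have hZ := (gaussZ_toReal_pos_and_tsum_dual_pos hP m).1
  refine le_trans ?_ (inv_gaussZ_mul_exp_le_tsum_dual hP m (fun j => round (m j)))
  refine mul_le_mul_of_nonneg_left (Real.exp_le_exp.2 ?_) (inv_nonneg.2 hZ.le)
  have hv : ∀ j, |((round (m j) : ℤ) : ℝ) - m j| ≤ 1 / 2 := by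
    intro j
    rw [abs_sub_comm]
    exact abs_sub_round (m j)
  have h := form_le_quarter_sum_abs P (v := fun j => ((round (m j) : ℤ) : ℝ) - m j) hv
  linarith

/-- **Explicit uniform lower bound**: with a lower form bound `c‖v‖² ≤ vᵀPv` (`c > 0`),
`(√c/√(2π))ᴺ · e^{−Σ_{ij}|P_{ij}|/8} ≤ Σ_ρ e^{−2π² ρᵀP⁻¹ρ} cos(2π ρ·m)` for every tilt `m`
(`GaussianToolkit.gaussZ_le`: `Z_P ≤ (√(2π)/√c)ᴺ`). [folklore] -/
theorem pow_mul_exp_le_tsum_dual_uniform (hP : P.PosDef) {c : ℝ} (hc : 0 < c)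
    (hlow : ∀ v : Fin N → ℝ, c * ‖(toLp 2 v : EuclideanSpace ℝ (Fin N))‖ ^ 2 ≤ v ⬝ᵥ P *ᵥ v) (m : Fin N → ℝ) :
    (Real.sqrt c / Real.sqrt (2 * π)) ^ N * Real.exp (-(∑ i, ∑ j, |P i j|) / 8)
      ≤ ∑' ρ : Fin N → ℤ, Real.exp (-2 * π ^ 2 * ((fun j => (ρ j : ℝ)) ⬝ᵥ P⁻¹ *ᵥ fun j => (ρ j : ℝ))) *
          Real.cos (2 * π * ∑ j, (ρ j : ℝ) * m j) := by
  have hZ := (gaussZ_toReal_pos_and_tsum_dual_pos hP m).1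
  refine le_trans (mul_le_mul_of_nonneg_right ?_ (Real.exp_pos _).le) (inv_gaussZ_mul_exp_le_tsum_dual_uniform hP m)
  -- `Z_P ≤ (√(2π)/√c)^N`, hence `(√c/√(2π))^N ≤ Z_P⁻¹`
  have hle := gaussZ_le (ι := Fin N) hc hlow
  have hsc : 0 < Real.sqrt c := Real.sqrt_pos.2 hc
  have hs2 : 0 < Real.sqrt (2 * π) := Real.sqrt_pos.2 (by positivity)
  have hpow : 0 < (Real.sqrt (2 * π) / Real.sqrt c) ^ N := by positivity
  have hZle : (gaussZ P).toReal ≤ (Real.sqrt (2 * π) / Real.sqrt c) ^ Fintype.card (Fin N) := by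
    have h := ENNReal.toReal_mono ENNReal.ofReal_ne_top hle
    rwa [ENNReal.toReal_ofReal (by positivity)] at h
  rw [Fintype.card_fin] at hZle
  have hinv : ((Real.sqrt (2 * π) / Real.sqrt c) ^ N)⁻¹ ≤ (gaussZ P).toReal⁻¹ := by
    exact inv_anti₀ hZ hZle
  refine le_trans (le_of_eq ?_) hinv
  rw [← inv_pow, inv_div]

/-- **Upper bound by the untilted series**: `Σ_ρ e^{−½ρᵀAρ} cos(τ·ρ) ≤ Σ_ρ e^{−½ρᵀAρ}`. [folklore] -/
theorem tsum_exp_neg_half_form_mul_cos_le {A : Matrix (Fin N) (Fin N) ℝ} (hA : A.PosDef) (τ : Fin N → ℝ) :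
    ∑' ρ : Fin N → ℤ, Real.exp (-((fun j => (ρ j : ℝ)) ⬝ᵥ A *ᵥ fun j => (ρ j : ℝ)) / 2) * Real.cos (∑ j, (ρ j : ℝ) * τ j)
      ≤ ∑' ρ : Fin N → ℤ, Real.exp (-((fun j => (ρ j : ℝ)) ⬝ᵥ A *ᵥ fun j => (ρ j : ℝ)) / 2) := by
  have hs := summable_exp_neg_half_form_sub hA 0
  simp only [Pi.zero_apply, sub_zero] at hs
  refine (summable_exp_neg_half_form_mul_cos hA τ).tsum_le_tsum (fun ρ => ?_) hs
  exact mul_le_of_le_one_right (Real.exp_pos _).le (Real.cos_le_one _)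

/-- **Uniform lower bound, covariance form**: for a positive definite `A`, with `P := 4π²A⁻¹` (so that the dual form is
`½ ρᵀAρ`), `Z_P⁻¹ e^{−Σ|P_{ij}|/8} ≤ Σ_ρ e^{−½ρᵀAρ} cos(τ·ρ)` for EVERY `τ` — the tilted series is bounded below
uniformly in the tilt. [folklore] -/
theorem inv_gaussZ_mul_exp_le_tsum_exp_neg_half_form_mul_cos {A : Matrix (Fin N) (Fin N) ℝ} (hA : A.PosDef)
    (τ : Fin N → ℝ) :
    (gaussZ ((4 * π ^ 2)⁻¹ • A)⁻¹).toReal⁻¹ * Real.exp (-(∑ i, ∑ j, |((4 * π ^ 2)⁻¹ • A)⁻¹ i j|) / 8)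
      ≤ ∑' ρ : Fin N → ℤ, Real.exp (-((fun j => (ρ j : ℝ)) ⬝ᵥ A *ᵥ fun j => (ρ j : ℝ)) / 2) *
          Real.cos (∑ j, (ρ j : ℝ) * τ j) := by
  have h4 : (0 : ℝ) < (4 * π ^ 2)⁻¹ := by positivity
  set B : Matrix (Fin N) (Fin N) ℝ := (4 * π ^ 2)⁻¹ • A with hB
  have hBpd : B.PosDef := hA.smul h4
  have hPpd : B⁻¹.PosDef := hBpd.inv
  have hBunit : IsUnit B.det := (Matrix.isUnit_iff_isUnit_det _).1 hBpd.isUnit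
  have hPinv : B⁻¹⁻¹ = B := Matrix.nonsing_inv_nonsing_inv B hBunit
  have h := inv_gaussZ_mul_exp_le_tsum_dual_uniform hPpd (fun j => τ j / (2 * π))
  rw [hPinv] at h
  convert h using 1
  refine tsum_congr fun ρ => ?_
  congr 1
  · congr 1
    simp only [hB, Matrix.smul_mulVec, dotProduct_smul, smul_eq_mul]
    field_simp
    ring
  · congr 1
    rw [Finset.mul_sum]
    refine Finset.sum_congr rfl fun j _ => ?_
    field_simp

/-! ### The charge representation (the theta transformation read from the tilted side) -/

/-- **Charge representation of a tilted theta series**: for a positive definite `A` and every `τ`, with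
`P := (A/(4π²))⁻¹`,
`Σ_ρ e^{−½ρᵀAρ} cos(τ·ρ) = Z_P⁻¹ · Σ_{k∈ℤᴺ} e^{−½(k − τ/(2π))ᵀP(k − τ/(2π))}` —
a normalised sum of POSITIVE Gaussians centred at the lattice points ("charges" `k`), whose widths are governed by
`P ~ A⁻¹`: when `A` is small the tilt selects the charges nearest to `τ/(2π)`. [folklore] -/
theorem tsum_exp_neg_half_form_mul_cos_eq_charge {A : Matrix (Fin N) (Fin N) ℝ} (hA : A.PosDef) (τ : Fin N → ℝ) :
    ∑' ρ : Fin N → ℤ, Real.exp (-((fun j => (ρ j : ℝ)) ⬝ᵥ A *ᵥ fun j => (ρ j : ℝ)) / 2) * Real.cos (∑ j, (ρ j : ℝ) * τ j)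
      = (gaussZ ((4 * π ^ 2)⁻¹ • A)⁻¹).toReal⁻¹ *
          ∑' k : Fin N → ℤ, Real.exp (-((fun j => (k j : ℝ) - τ j / (2 * π)) ⬝ᵥ ((4 * π ^ 2)⁻¹ • A)⁻¹ *ᵥ
            (fun j => (k j : ℝ) - τ j / (2 * π))) / 2) := by
  have h4 : (0 : ℝ) < (4 * π ^ 2)⁻¹ := by positivity
  set B : Matrix (Fin N) (Fin N) ℝ := (4 * π ^ 2)⁻¹ • A with hB
  have hBpd : B.PosDef := hA.smul h4
  have hPpd : B⁻¹.PosDef := hBpd.inv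
  have hBunit : IsUnit B.det := (Matrix.isUnit_iff_isUnit_det _).1 hBpd.isUnit
  have hPinv : B⁻¹⁻¹ = B := Matrix.nonsing_inv_nonsing_inv B hBunit
  obtain ⟨c, C, hc, hC, hlow, hup⟩ := exists_form_bounds_of_posDef hPpd
  have hid := tsum_exp_neg_half_form_sub_eq hPpd hc hC hlow hup (fun j => τ j / (2 * π))
  have hZ := (gaussZ_toReal_pos_and_tsum_dual_pos hPpd (fun j => τ j / (2 * π))).1
  rw [hPinv] at hid
  -- the dual series of the transformation is the tilted series
  have hdual : ∑' ρ : Fin N → ℤ, Real.exp (-2 * π ^ 2 * ((fun j => (ρ j : ℝ)) ⬝ᵥ B *ᵥ fun j => (ρ j : ℝ))) *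
        Real.cos (2 * π * ∑ j, (ρ j : ℝ) * (τ j / (2 * π)))
      = ∑' ρ : Fin N → ℤ, Real.exp (-((fun j => (ρ j : ℝ)) ⬝ᵥ A *ᵥ fun j => (ρ j : ℝ)) / 2) *
          Real.cos (∑ j, (ρ j : ℝ) * τ j) := by
    refine tsum_congr fun ρ => ?_
    congr 1
    · congr 1
      simp only [hB, Matrix.smul_mulVec, dotProduct_smul, smul_eq_mul]
      field_simp
      ring
    · congr 1
      rw [Finset.mul_sum]
      refine Finset.sum_congr rfl fun j _ => ?_
      field_simp
  rw [hdual] at hid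
  rw [hid, ← mul_assoc, inv_mul_cancel₀ hZ.ne', one_mul]

/-! ### Shifted lattice Gaussian sums are maximal at zero shift -/

/-- **A shifted lattice Gaussian sum is largest at zero shift**: for a positive definite `P` and every `m ∈ ℝᴺ`,
`Σ_{k∈ℤᴺ} e^{−½(k−m)ᵀP(k−m)} ≤ Σ_{k∈ℤᴺ} e^{−½kᵀPk}` (both sides are `Z_P` times a tilted theta series with positive
coefficients, `cos ≤ 1`; `tsum_exp_neg_half_form_mul_cos_eq_charge`, `tsum_exp_neg_half_form_mul_cos_le`). [folklore] -/
theorem tsum_exp_neg_half_form_sub_le_tsum (hP : P.PosDef) (m : Fin N → ℝ) :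
    ∑' k : Fin N → ℤ, Real.exp (-((fun j => (k j : ℝ) - m j) ⬝ᵥ P *ᵥ (fun j => (k j : ℝ) - m j)) / 2)
      ≤ ∑' k : Fin N → ℤ, Real.exp (-((fun j => (k j : ℝ)) ⬝ᵥ P *ᵥ fun j => (k j : ℝ)) / 2) := by
  -- `A := 4π² P⁻¹`, so that `(A/(4π²))⁻¹ = P`
  have h4 : (0 : ℝ) < 4 * π ^ 2 := by positivity
  set A : Matrix (Fin N) (Fin N) ℝ := (4 * π ^ 2) • P⁻¹ with hA
  have hApd : A.PosDef := hP.inv.smul h4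
  have hPunit : IsUnit P.det := (Matrix.isUnit_iff_isUnit_det _).1 hP.isUnit
  have hB : (4 * π ^ 2)⁻¹ • A = P⁻¹ := by
    rw [hA, smul_smul, inv_mul_cancel₀ h4.ne', one_smul]
  have hBinv : ((4 * π ^ 2)⁻¹ • A)⁻¹ = P := by rw [hB, Matrix.nonsing_inv_nonsing_inv P hPunit]
  have hZ := (gaussZ_toReal_pos_and_tsum_dual_pos (hBinv ▸ (hApd.smul (by positivity : (0:ℝ) < (4 * π ^ 2)⁻¹)).inv)
    (fun j => (2 * π * m j) / (2 * π))).1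
  -- the charge representation at the tilts `τ = 2πm` and `τ = 0`
  have hm := tsum_exp_neg_half_form_mul_cos_eq_charge hApd (fun j => 2 * π * m j)
  have h0 := tsum_exp_neg_half_form_mul_cos_eq_charge hApd 0
  rw [hBinv] at hm h0
  have hle := tsum_exp_neg_half_form_mul_cos_le hApd (fun j => 2 * π * m j)
  -- rewrite the untilted series as the `τ = 0` tilted one
  have h0' : ∑' ρ : Fin N → ℤ, Real.exp (-((fun j => (ρ j : ℝ)) ⬝ᵥ A *ᵥ fun j => (ρ j : ℝ)) / 2)
      = ∑' ρ : Fin N → ℤ, Real.exp (-((fun j => (ρ j : ℝ)) ⬝ᵥ A *ᵥ fun j => (ρ j : ℝ)) / 2)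
          * Real.cos (∑ j, (ρ j : ℝ) * (0 : Fin N → ℝ) j) := by
    refine tsum_congr fun ρ => ?_
    simp
  rw [h0'] at hle
  rw [hm, h0] at hle
  -- cancel `Z⁻¹ > 0` and identify the shifts
  have hπ : ∀ j, 2 * π * m j / (2 * π) = m j := fun j => by field_simp
  simp only [hπ, Pi.zero_apply, zero_div, sub_zero] at hle
  exact le_of_mul_le_mul_left hle (inv_pos.2 hZ)

end GaussianPoisson

end Literature.MathematicalPhysics.QuantumFieldTheory

end
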